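import Summits.BirchSwinnertonDyer.BirchSwinnertonDyer.Theorems.SemiOrdinaryEisensteinDescentWildKolyvaginUpperAtThreeTight
import Summits.BirchSwinnertonDyer.BirchSwinnertonDyer.Theorems.SemiOrdinaryEisensteinDescentWildKolyvaginUpperAtThreeOfJointUpper
import Summits.BirchSwinnertonDyer.BirchSwinnertonDyer.Theorems.SemiOrdinaryEisensteinDescentWildKolyvaginUpperAtThreeOfMinftyGe
import Summits.BirchSwinnertonDyer.BirchSwinnertonDyer.Theorems.SemiOrdinaryEisensteinDescentWildKolyvaginUpperAtThreeStubMinftyFinite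
import HarnessLib

/-!
# The Σ-form σ-DIVISIBILITY (crux J‴ stmt-BirchSwinnertonDyer-25898 / J′ 24702 / the tower aside J 20760) is TIGHT on TOWER rows:
# it follows from `BSD₃(E) ∧ BSD₃(E^{d_K})` — hence from the leaf `WAllExclAddWildRankOneSurj` and the residual `WAllExclAddWildRankZero` —
# modulo named print and the typed Kolyvagin–McCallum structure-theorem shape; J (20760) BY NAME from the leaf
# (route `SemiOrdinaryEisensteinDescent`; width seat `bsd-wall-soed-p2-w2` g7; `--supports stmt-BirchSwinnertonDyer-25898`, helper)

WHY. Line `birth` of J‴ has ONE research stub, `stub_flatMultiCarrier` (σ-divisibility of the Kolyvagin points to the full depth on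
multi-Tamagawa-carrier frames = Büyükboduk 2009 §4.2 Q1 at the additive prime `3`). Every memo of the column says «true iff the ≤-half of
BSD₃(E/K); no kill short of a BSD counterexample» — for the INDEX currency this is the kernel theorem KoTight (p584719/p585064,
`wildKolyvaginUpperAtThree_of_wAllExclAddWildRankOneSurj_of_wAllExclAddWildRankZero`). THIS FILE proves it for the POINT currency of
J / J′ / J‴ / `stub_flatMultiCarrier`, closing the loop  BSD₃(E) ∧ BSD₃(E^{d_K}) ⟹ co-STEP L at slack `v₃ c` (p580751
`indexUpperBoundLeAt_of_bsdp_of_bsdp`) ⟹ `M_∞ ≥ ord₃ ∏ c_q + v₃ c` in CLASS currency (structure theorem shape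
`KolyvaginStructureThreeShape` as an EQUALITY + `M_∞` finite, p567859 `stub_minftyFinite`) ⟹ `3^{s′} ∣ P(n)` in POINT currency at every depth
`s′ ≤ ord₃ ∏ c_q + v₃ c` (p567352 `pDiv_of_minftyGe`, McCallum Cor. 4.5). The structure-theorem shape is typed with the `3`-adic TOWER binder,
so the certificate lives on tower rows: J (20760, tower binder) BY NAME; J′/J‴/`stub_flatMultiCarrier` frame-wise at every tower frame.

WHAT IS PROVED (theorems only; no definition, no named fact, no `sorry`; CONDITIONAL on the displayed named facts / typed shape and on the two
conjectural leaves where they appear as hypotheses — nothing is asserted about any curve):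
* §1 `minftyGe_of_structure_of_indexUpperBound` — at a tower frame of the cell: structure shape + co-STEP L at slack `v₃ c`
  (`Upper.IndexUpperBoundLeAt W 3 K P (v₃ c(Dt))`) ⟹ `MinftyGe … (ord₃ ∏ c_q + v₃ c(Dt))`; `sigma_at_of_structure_of_indexUpperBound` — … ⟹
  J's conclusion at the frame (every depth `s′ ≤ ord₃ ∏ c_q + v₃ c`, every Zhang–Kolyvagin `n` of index `≥ s′`: `Koly.PDiv d 3 s′`).
* §2 `sigma_at_of_bsdp_of_bsdp` — the same from `BSDp W 3 ∧ BSDp Wd 3` (`Wd` a globally minimal model of `E^{d_K}`) + {Gross–Zagier I.(6.3),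
  Kolyvagin, GZK, modularity, GZ86 I.(7.3)} + the structure shape.
* §3 **`wildSigmaDivisibilityAtThree_of_wAllExclAddWildRankOneSurj_of_wAllExclAddWildRankZero`** — the aside J `WildSigmaDivisibilityAtThree`
  (stmt-20760, tower binder) BY NAME from the leaf `WAllExclAddWildRankOneSurj`, the residual `WAllExclAddWildRankZero` (= route item Z 20387) and
  the same named inputs; `sigma_at_of_wAllExclAddWildRankOneSurj_of_wAllExclAddWildRankZero` — J′'s (⊇ J‴'s, ⊇ `stub_flatMultiCarrier`'s)
  conclusion at every TOWER frame from the same.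
NET: on tower rows the Kolyvagin column's research statement carries NO SURPLUS over BSD₃ (given the structure theorem): a counterexample to
`stub_flatMultiCarrier` there is a counterexample to BSD₃(E) or BSD₃(E^{d_K}) or to the Kolyvagin–McCallum structure theorem at `3`. Off the
tower (ρ̄₃ onto, ρ₉ not) nothing is claimed here. HONEST FRAMING: `KolyvaginStructureThreeShape` is a typed `Prop` (McCallum Thm. 5.4/5.8 at
`p = 3 ∣ N`, flagged for referee line-checking in `Additive/WildThreeRefinedKolyvagin.lean`), taken as a hypothesis; BSD is not proved by this.

References: [McCallumLMS1991] §4 Cor. 4.5, §5 Lemma 5.1, Thm. 5.4, Cor. 5.6, Thm. 5.8; [GrossZagier1986] I (6.3), (7.3), V (2.2);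
[JetchevSkinnerWan2017] §7.4.1; [Jetchev2008] Conj. 1.3; [WZhang2014] §3.8; [Miller2011LMS] Def. 1.1.
-/

set_option autoImplicit false
set_option linter.dupNamespace false -- `Summit.BirchSwinnertonDyer.BirchSwinnertonDyer.…` is the tree's layout (D-0017)

noncomputable section

open scoped Classical

namespace Summit.BirchSwinnertonDyer.BirchSwinnertonDyer.Theorems.WildSigmaDivisibilityAtThreeTight

open WeierstrassCurve NumberField IsDedekindDomain Field Literature.NumberTheory.EllipticCurves
  Literature.NumberTheory.EllipticCurves.ModularForms
  Literature.NumberTheory.EllipticCurves.Rank1Residual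
  Literature.NumberTheory.EllipticCurves.Rank1Residual.Typed
  Summit.BirchSwinnertonDyer.Rank1Residual
  Summit.BirchSwinnertonDyer.Rank1Residual.Additive
  Summit.BirchSwinnertonDyer.Rank1Residual.X11b
  Summit.BirchSwinnertonDyer.Rank1Residual.X11b.Three
  Summit.BirchSwinnertonDyer.BirchSwinnertonDyer.Theses.SemiOrdinaryEisensteinDescent
  Summit.BirchSwinnertonDyer.BirchSwinnertonDyer.Theorems.SchneiderFree
  Summit.BirchSwinnertonDyer.BirchSwinnertonDyer.Theorems.WildKolyvaginUpperAtThreeTight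
  Summit.BirchSwinnertonDyer.BirchSwinnertonDyer.Theorems.WildKolyvaginUpperAtThreeOfJointUpper
  Summit.BirchSwinnertonDyer.BirchSwinnertonDyer.Theorems.WildKolyvaginUpperAtThreeOfMinftyGe
  Summit.BirchSwinnertonDyer.BirchSwinnertonDyer.Theorems.WildKolyvaginUpperAtThree

/-! ## §1 Structure theorem + co-STEP L at slack `v₃ c` ⟹ `M_∞ ≥ ord₃ ∏ c_q + v₃ c` ⟹ σ-divisibility at the frame -/

/-- **co-STEP L ⟹ `M_∞ ≥ t` in class currency** (`t = ord₃ ∏ c_q + v₃ c(Dt)`), at one TOWER frame of the cell: the structure shape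
`ord₃ #Ш(E/K) + 2·M_∞ = 2·ord₃ [E(K):ℤP]` (McCallum Thm. 5.4/5.8 at `3`, typed, hypothesis `hS`) with `M_∞` FINITE on the frame (the landed
`stub_minftyFinite`: `c_{M₀+1}(1) ≠ 0`) and the inequality `ord₃ #Ш(E/K) + 2·ord₃ ∏ c_q + 2·v₃ c ≤ 2·ord₃ [E(K):ℤP]`
(`Upper.IndexUpperBoundLeAt W 3 K P (v₃ c)`) give `M_∞ ≥ t` by monotonicity. [cite: McCallumLMS1991, Thm. 5.4 (p. 288) and Thm. 5.8 (p. 290)]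
[cite: WZhang2014, §3.8 (M_∞)] -/
theorem minftyGe_of_structure_of_indexUpperBound (hS : AdditiveThree.KolyvaginStructureThreeShape)
    (W : WeierstrassCurve ℚ) [W.IsElliptic] [W.IsGloballyMinimal] [NeZero (W.conductorNorm ℤ)]
    (K : Type) [Field K] [NumberField K] (Dt : ModularParametrizationData W (W.conductorNorm ℤ))
    (H : HeegnerDatum (W.conductorNorm ℤ) (NumberField.discr K)) (ι : K →+* ℂ) (P : (W.baseChange K).toAffine.Point)
    (hO6 : ClassO6 W 3) (hsurj : W.HasSurjectiveModNGaloisRep 3) (hr : W.analyticRank = 1)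
    (hρ : AdditiveThree.TowerSurjThree W) (hK : IsImaginaryQuadratic K)
    (hHH : SatisfiesHeegnerHypothesis (W.conductorNorm ℤ) K)
    (hLd : (W.quadraticTwist (NumberField.discr K : ℚ)).entireLFunction 1 ≠ 0)
    (hP : WeierstrassCurve.Affine.Point.map ι.toRatAlgHom P = heegnerPointComplex Dt H)
    (hnt : ¬ IsOfFinAddOrder P) (hodd : Odd (NumberField.discr K)) (h3 : NumberField.discr K ≠ -3)
    (hup : Upper.IndexUpperBoundLeAt W 3 K P (padicValNat 3 Dt.c.natAbs)) :
    AdditiveThree.MinftyGe W K Dt H.β ι (padicValNat 3 W.tamagawaProduct + padicValNat 3 Dt.c.natAbs) := by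
  have h4 : NumberField.discr K ≠ -4 := by
    rintro h; rw [h] at hodd; exact (by decide : ¬ Odd (-4 : ℤ)) hodd
  -- `M_∞ = m` exists on the frame (landed `stub_minftyFinite`)
  obtain ⟨m, hm⟩ := stub_minftyFinite W hO6 hsurj hr hρ K hK hodd h3 hHH hLd Dt H ι P hP hnt
  -- structure theorem: `ord₃ #Ш + 2m = 2·ord₃ [E(K):ℤP]`
  obtain ⟨-, hid⟩ := hS W hρ K hK h3 h4 hHH Dt H ι P hP hnt m hm
  -- co-STEP L at slack `v₃ c`: `ord₃ #Ш + 2·ord₃ ∏c + 2·v₃ c ≤ 2·ord₃ [E(K):ℤP]`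
  have hup' := hup
  unfold Upper.IndexUpperBoundLeAt at hup'
  exact AdditiveThree.minftyGe_mono W K Dt H.β ι (by omega) ((AdditiveThree.minftyEq_iff W K Dt H.β ι m).mp hm).1

/-- **co-STEP L ⟹ σ-divisibility to the full depth, at one tower frame**: §1 in class currency, then CLASS ⟹ POINT (p567352
`pDiv_of_minftyGe`: McCallum Cor. 4.5 at the level `M = s′`; `d_K < −4` from `d_K` odd `≠ −3`). So `3^{s′} ∣ P(n)` in `E(K[n])` for every
`s′ ≤ ord₃ ∏ c_q + v₃ c(Dt)` and every square-free Zhang–Kolyvagin `n` of index `≥ s′` — J's conclusion at the frame.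
[cite: McCallumLMS1991, §4 Cor. 4.5, Thm. 5.4] [cite: WZhang2014, §3.8] -/
theorem sigma_at_of_structure_of_indexUpperBound (hS : AdditiveThree.KolyvaginStructureThreeShape)
    (W : WeierstrassCurve ℚ) [W.IsElliptic] [W.IsGloballyMinimal] [NeZero (W.conductorNorm ℤ)]
    (K : Type) [Field K] [NumberField K] (Dt : ModularParametrizationData W (W.conductorNorm ℤ))
    (H : HeegnerDatum (W.conductorNorm ℤ) (NumberField.discr K)) (ι : K →+* ℂ) (P : (W.baseChange K).toAffine.Point)
    (hO6 : ClassO6 W 3) (hsurj : W.HasSurjectiveModNGaloisRep 3) (hr : W.analyticRank = 1)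
    (hρ : AdditiveThree.TowerSurjThree W) (hK : IsImaginaryQuadratic K)
    (hHH : SatisfiesHeegnerHypothesis (W.conductorNorm ℤ) K)
    (hLd : (W.quadraticTwist (NumberField.discr K : ℚ)).entireLFunction 1 ≠ 0)
    (hP : WeierstrassCurve.Affine.Point.map ι.toRatAlgHom P = heegnerPointComplex Dt H)
    (hnt : ¬ IsOfFinAddOrder P) (hodd : Odd (NumberField.discr K)) (h3 : NumberField.discr K ≠ -3)
    (hup : Upper.IndexUpperBoundLeAt W 3 K P (padicValNat 3 Dt.c.natAbs)) :
    ∀ (s' : ℕ), s' ≤ padicValNat 3 W.tamagawaProduct + padicValNat 3 Dt.c.natAbs →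
      ∀ (n : ℕ) (d : KolyvaginHeegnerData Dt H.β ι n), Squarefree n →
        (∀ ℓ ∈ n.primeFactors, Zhang2014.IsKolyvaginPrime (W.conductorNorm ℤ) W K 3 ℓ ∧
          s' ≤ Zhang2014.kolyvaginIndex W 3 ℓ) → Koly.PDiv d 3 s' := by
  intro s' hs' n d hn hℓ
  have hD : NumberField.discr K < -4 := discr_lt_neg_four_of_odd hK hodd h3 H.dvd_sq_sub
  exact pDiv_of_minftyGe W K hK hHH hD hsurj Dt H.β ι
    (minftyGe_of_structure_of_indexUpperBound hS W K Dt H ι P hO6 hsurj hr hρ hK hHH hLd hP hnt hodd h3 hup) hs' d hn hℓ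

/-! ## §2 `BSD₃(E) ∧ BSD₃(E^{d_K})` ⟹ σ-divisibility at every tower frame -/

/-- **σ-divisibility at a tower frame from the two BSD₃'s.** For a frame of the cell at the conductor level (onto wild `r = 1` curve `W`,
`3`-adic tower, admissible `K`, `Dt`, `H`, `ι`, non-torsion `P ↦ y_K`) and a globally minimal model `Wd` of `E^{d_K}`: `BSDp W 3 ∧ BSDp Wd 3`
+ {Gross–Zagier I.(6.3), Kolyvagin, GZK, modularity, GZ86 I.(7.3)} give co-STEP L at slack `v₃ c` (p580751
`indexUpperBoundLeAt_of_bsdp_of_bsdp`), and §1 concludes. CONDITIONAL on the five named facts, the structure shape and the two BSD₃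
hypotheses. [cite: GrossZagier1986, Thm. I.(6.3), (7.3) and V (2.2)] [cite: McCallumLMS1991, Thm. 5.4 and Cor. 4.5] [cite: Miller2011LMS, Def. 1.1] -/
theorem sigma_at_of_bsdp_of_bsdp (hS : AdditiveThree.KolyvaginStructureThreeShape)
    (hGZ : ∀ (N : ℕ) [NeZero N] (W : WeierstrassCurve ℚ) (K : Type) [Field K] [NumberField K],
      gross_zagier N W K)
    (hKo : ∀ (N : ℕ) [NeZero N] (W : WeierstrassCurve ℚ) (K : Type) [Field K] [NumberField K],
      kolyvagin N W K)
    (hGZK : rank_eq_analyticRank_of_analyticRank_le_one) (hmod : hasEntireLFunction_rat)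
    (hGZ73 : GrossZagier1986_thm_I_7_3)
    (W : WeierstrassCurve ℚ) [W.IsElliptic] [W.IsGloballyMinimal] [NeZero (W.conductorNorm ℤ)]
    (K : Type) [Field K] [NumberField K] (Dt : ModularParametrizationData W (W.conductorNorm ℤ))
    (H : HeegnerDatum (W.conductorNorm ℤ) (NumberField.discr K)) (ι : K →+* ℂ) (P : (W.baseChange K).toAffine.Point)
    (Wd : WeierstrassCurve ℚ) [Wd.IsElliptic] [Wd.IsGloballyMinimal]
    (hO6 : ClassO6 W 3) (hsurj : W.HasSurjectiveModNGaloisRep 3) (hr : W.analyticRank = 1)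
    (hρ : AdditiveThree.TowerSurjThree W) (hK : IsImaginaryQuadratic K)
    (hHH : SatisfiesHeegnerHypothesis (W.conductorNorm ℤ) K)
    (hLd : (W.quadraticTwist (NumberField.discr K : ℚ)).entireLFunction 1 ≠ 0)
    (hP : WeierstrassCurve.Affine.Point.map ι.toRatAlgHom P = heegnerPointComplex Dt H)
    (hnt : ¬ IsOfFinAddOrder P) (hodd : Odd (NumberField.discr K)) (h3 : NumberField.discr K ≠ -3)
    (hC : ∃ C : VariableChange ℚ, C • W.quadraticTwist (NumberField.discr K : ℚ) = Wd)
    (hbsd : BSDp W 3) (hbsdd : BSDp Wd 3) :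
    ∀ (s' : ℕ), s' ≤ padicValNat 3 W.tamagawaProduct + padicValNat 3 Dt.c.natAbs →
      ∀ (n : ℕ) (d : KolyvaginHeegnerData Dt H.β ι n), Squarefree n →
        (∀ ℓ ∈ n.primeFactors, Zhang2014.IsKolyvaginPrime (W.conductorNorm ℤ) W K 3 ℓ ∧
          s' ≤ Zhang2014.kolyvaginIndex W 3 ℓ) → Koly.PDiv d 3 s' := by
  haveI : Fact (Nat.Prime 3) := ⟨Nat.prime_three⟩
  have h3N : 3 ∣ W.conductorNorm ℤ :=
    (W.dvd_conductorNorm_iff_not_hasGoodReductionAtPrime 3).mpr (not_good_of_addv W 3 hO6.2.1)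
  have hw : ¬ 3 ∣ Units.torsionOrder K :=
    (X11b.Three.not_dvd_discr_and_not_dvd_torsionOrder_of_heegner hK hHH (by decide) h3N).2
  have hup : Upper.IndexUpperBoundLeAt W 3 K P (padicValNat 3 Dt.c.natAbs) :=
    indexUpperBoundLeAt_of_bsdp_of_bsdp hGZ hKo hGZK hmod hGZ73 W 3 (W.conductorNorm ℤ) K Dt H ι P Wd hr rfl h3N hK hodd hw
      hHH hLd hP hC (by decide) hbsd hbsdd
  exact sigma_at_of_structure_of_indexUpperBound hS W K Dt H ι P hO6 hsurj hr hρ hK hHH hLd hP hnt hodd h3 hup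

/-! ## §3 From the leaf and the rank-zero residual: J (20760) BY NAME, and J′/J‴'s conclusion at every tower frame -/

/-- **σ-divisibility at every TOWER frame from the leaf `WAllExclAddWildRankOneSurj` and the residual `WAllExclAddWildRankZero`**
(any level `N = N_E`): `E` is non-CM (`ρ̄₃` onto) so the leaf gives `BSD₃(E)`; a globally minimal model `Wd` of `E^{d_K}` exists
(`hasGlobalMinimalModel_rat_holds`) and is a non-CM O6 curve of analytic rank `0` (`classO6_twist_of_heegner`), so the residual gives
`BSD₃(Wd)`; then §2. This is the conclusion of J′ (24702) / J‴ (25898) / `stub_flatMultiCarrier` at the frame — on tower rows these research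
statements carry NO SURPLUS over BSD₃ modulo the named inputs. CONDITIONAL on the two conjectural leaves (hypotheses), the five named facts and the
structure shape; nothing asserted. [cite: GrossZagier1986, Thm. I.(6.3), (7.3) and V (2.2)] [cite: McCallumLMS1991, Thm. 5.4 and Cor. 4.5]
[cite: Jetchev2008, Conj. 1.3 (p. 812)] -/
theorem sigma_at_of_wAllExclAddWildRankOneSurj_of_wAllExclAddWildRankZero (hS : AdditiveThree.KolyvaginStructureThreeShape)
    (hGZ : ∀ (N : ℕ) [NeZero N] (W : WeierstrassCurve ℚ) (K : Type) [Field K] [NumberField K],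
      gross_zagier N W K)
    (hKo : ∀ (N : ℕ) [NeZero N] (W : WeierstrassCurve ℚ) (K : Type) [Field K] [NumberField K],
      kolyvagin N W K)
    (hGZK : rank_eq_analyticRank_of_analyticRank_le_one) (hmod : hasEntireLFunction_rat)
    (hGZ73 : GrossZagier1986_thm_I_7_3)
    (hLeaf : Summit.BirchSwinnertonDyer.WAllExclAddWildRankOneSurj)
    (hZ : Summit.BirchSwinnertonDyer.WAllExclAddWildRankZero)
    (W : WeierstrassCurve ℚ) [W.IsElliptic] [W.IsGloballyMinimal] (N : ℕ) [NeZero N] (K : Type)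
    [Field K] [NumberField K] (Dt : ModularParametrizationData W N)
    (H : HeegnerDatum N (NumberField.discr K)) (ι : K →+* ℂ) (P : (W.baseChange K).toAffine.Point)
    (hO6 : ClassO6 W 3) (hsurj : W.HasSurjectiveModNGaloisRep 3) (hr : W.analyticRank = 1) (hN : W.conductorNorm ℤ = N)
    (hK : IsImaginaryQuadratic K) (hHH : SatisfiesHeegnerHypothesis N K)
    (hLd : (W.quadraticTwist (NumberField.discr K : ℚ)).entireLFunction 1 ≠ 0)
    (hP : WeierstrassCurve.Affine.Point.map ι.toRatAlgHom P = heegnerPointComplex Dt H)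
    (hnt : ¬ IsOfFinAddOrder P) (hodd : Odd (NumberField.discr K)) (h3 : NumberField.discr K ≠ -3)
    (hρ : AdditiveThree.TowerSurjThree W) :
    ∀ (s' : ℕ), s' ≤ padicValNat 3 W.tamagawaProduct + padicValNat 3 Dt.c.natAbs →
      ∀ (n : ℕ) (d : KolyvaginHeegnerData Dt H.β ι n), Squarefree n →
        (∀ ℓ ∈ n.primeFactors, Zhang2014.IsKolyvaginPrime N W K 3 ℓ ∧
          s' ≤ Zhang2014.kolyvaginIndex W 3 ℓ) → Koly.PDiv d 3 s' := by
  subst hN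
  haveI : Fact (Nat.Prime 3) := ⟨Nat.prime_three⟩
  -- `E` is non-CM (onto mod `3`), hence `BSD₃(E)` from the leaf
  have hCM : ¬ W.HasCM := fun hCM ↦
    W.not_hasSurjectiveModNGaloisRep_of_hasCM hCM Nat.prime_three (by decide) hsurj
  have hW : BSDp W 3 := hLeaf W hCM hO6 hsurj hr
  -- a globally minimal model of the twist: a non-CM O6 row of analytic rank `0`, hence `BSD₃` from the residual
  have hD0 : (NumberField.discr K : ℚ) ≠ 0 := by exact_mod_cast NumberField.discr_ne_zero K
  haveI : (W.quadraticTwist (NumberField.discr K : ℚ)).IsElliptic := W.isElliptic_quadraticTwist hD0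
  obtain ⟨Cd, hCd⟩ := hasGlobalMinimalModel_rat_holds (W.quadraticTwist (NumberField.discr K : ℚ))
  haveI : (Cd • W.quadraticTwist (NumberField.discr K : ℚ)).IsGloballyMinimal := hCd
  set Wd := Cd • W.quadraticTwist (NumberField.discr K : ℚ) with hWd_def
  obtain ⟨hO6d, hjd⟩ := classO6_twist_of_heegner W hO6 K hK hHH hodd Wd Cd rfl
  have hCMd : ¬ Wd.HasCM := fun h ↦ hCM ((hasCM_iff_of_j_eq hjd).mp h)
  have hLd1 : Wd.entireLFunction 1 ≠ 0 := by rw [hWd_def, entireLFunction_smul]; exact hLd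
  have hrd : Wd.analyticRank = 0 := analyticRank_eq_zero_of_entireLFunction_one_ne_zero Wd hLd1
  have hWdB : BSDp Wd 3 := hZ Wd hCMd hO6d hrd
  exact sigma_at_of_bsdp_of_bsdp hS hGZ hKo hGZK hmod hGZ73 W K Dt H ι P Wd hO6 hsurj hr hρ hK hHH hLd hP hnt hodd h3
    ⟨Cd, rfl⟩ hW hWdB

/-- **The aside J `WildSigmaDivisibilityAtThree` (stmt-BirchSwinnertonDyer-20760; Σ-form σ-divisibility WITH the `3`-adic tower binder) BY
NAME from the leaf `WAllExclAddWildRankOneSurj`, the residual `WAllExclAddWildRankZero` (= route item Z `WildRankZeroTwistAtThree`) and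
{structure shape, Gross–Zagier, Kolyvagin, GZK, modularity, GZ86 I.(7.3)}** — J is TIGHT: it carries no surplus over BSD₃ on its rows. (Its
tower-free children J′ 24702 / J‴ 25898 quantify over non-tower rows too; for them the frame-wise statement above is the certificate.)
CONDITIONAL on the two leaves and the named inputs; nothing asserted. [cite: McCallumLMS1991, Thm. 5.4 (p. 288) and Cor. 4.5]
[cite: GrossZagier1986, Thm. I.(6.3), (7.3) and V (2.2)] [cite: Jetchev2008, Conj. 1.3 (p. 812)] -/
theorem wildSigmaDivisibilityAtThree_of_wAllExclAddWildRankOneSurj_of_wAllExclAddWildRankZero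
    (hS : AdditiveThree.KolyvaginStructureThreeShape)
    (hGZ : ∀ (N : ℕ) [NeZero N] (W : WeierstrassCurve ℚ) (K : Type) [Field K] [NumberField K],
      gross_zagier N W K)
    (hKo : ∀ (N : ℕ) [NeZero N] (W : WeierstrassCurve ℚ) (K : Type) [Field K] [NumberField K],
      kolyvagin N W K)
    (hGZK : rank_eq_analyticRank_of_analyticRank_le_one) (hmod : hasEntireLFunction_rat)
    (hGZ73 : GrossZagier1986_thm_I_7_3)
    (hLeaf : Summit.BirchSwinnertonDyer.WAllExclAddWildRankOneSurj)
    (hZ : Summit.BirchSwinnertonDyer.WAllExclAddWildRankZero) :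
    WildSigmaDivisibilityAtThree := by
  intro W _ _ N _ K _ _ Dt H ι P hO6 hsurj hr hN hK hHH hLd hP hnt hodd h3 hρ
  exact sigma_at_of_wAllExclAddWildRankOneSurj_of_wAllExclAddWildRankZero hS hGZ hKo hGZK hmod hGZ73 hLeaf hZ W N K Dt H ι P
    hO6 hsurj hr hN hK hHH hLd hP hnt hodd h3 hρ

end Summit.BirchSwinnertonDyer.BirchSwinnertonDyer.Theorems.WildSigmaDivisibilityAtThreeTight

end
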